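import Literature.AlgebraicGeometry.Hyperkaehler.K3HilbertMukaiLatticeMonodromyInvariant
import Literature.Topology.FourManifolds.LatticeFormsPrimitiveEmbeddingSmallRank
import HarnessLib

/-!
# Every pair `(T, h)` of `Σ_n` is realised as `(T(X, h₁), ι(h₁))`
# (Apostolov, *Moduli spaces of polarized irreducible symplectic manifolds are not necessarily connected*,
# Ann. Inst. Fourier 64 (2014), §2 Prop. 2.3 — lattice part of the proof)

Layer `Literature/AlgebraicGeometry/Hyperkaehler`. Written for lane `lit-hodgefound` (Track 2 foundations; prover seat
`lit-hodgefound-p18`, gen 47, row g47-#13). Sequel of `K3HilbertMukaiLatticeMonodromyInvariant.lean` (g47-#11: the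
invariant `h ↦ [(T(h), ι h)]`, `T(h) = (ℤ·ι h ⊔ ι(L)^⊥)^⊥⊥`, is faithful). THEOREMS ONLY — no definition, no named
fact, no instance, no notation.

## Source, verbatim (A. Apostolov, Ann. Inst. Fourier 64 (2014) §2; held text `paper:arxiv-1109.0175` p. 10)

"**Proposition 2.3.** The image of the restriction `f|_{μ^{d,t}_n}` is `Σ_n^{d,t}`. Let `(T, h)` be a representative
of some isometry class in `Σ_n^{d,t}`. Let `δ` generate `h^⊥` in `T`. Then, by [Nik, Thm. 1.1.2.] we may choose a
primitive isometric embedding `j : T ↪ Λ̃`. Let `ι̃ : Λ_n ↪ Λ̃` be a primitive isometric embedding. Then the sublattice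
`ι̃(Λ_n)^⊥` is generated by a primitive element of degree `2n−2` and we may find an embedding `ι` in the
`O(Λ̃)`-orbit `[ι̃]` that `ι(Λ_n)^⊥ = ⟨j(δ)⟩`, since `O(Λ̃)` acts transitively on primitive elements. In particular,
`j(h) ∈ ι(Λ_n)`. […] Set `h₁ := ι⁻¹(j(h)) ∈ Λ_n`." (`Σ_n`: "isometry classes of pairs `(T, h)`, consisting of an
even rank 2 positive definite lattice `T` and a positive degree element `h ∈ T` such that `h^⊥ ≅ ⟨2n−2⟩`".)

## The formalisation (the lattice half of the proof; the moduli half — non-emptiness of `𝔐^{a,t₁}_{h₁^⊥}`, GAGA — is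
## not lattice theory)

§1 (general): `Λ` even unimodular with `n₊, n₋ ≥ 2`, a reference isometric `ι₀ : L → Λ` with `ι₀(L) = v₀^⊥`, `v₀`
primitive; an abstract even non-degenerate rank-2 lattice `(P, C)` with `h, δ ∈ P`, `(h, h) ≠ 0`, `h ⊥ δ`, `δ`
primitive, `(δ, δ) = (v₀, v₀) ≠ 0`. Then (`exists_embedding_pairIsometry`) there are `f ∈ O(Λ)`, `h₁ ∈ L` and an
isometric isomorphism `e : P ≅ T_{f∘ι₀}(h₁)` with `e(h) = (f ∘ ι₀)(h₁)`: `j : P ↪ Λ` primitive ("[Nik, Thm. 1.1.2]" — the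
tree's `exists_primitiveEmbedding_of_finrank_le_sigPos_sigNeg'`), `v := j(δ)` is primitive with `(v, v) = (v₀, v₀)`,
Eichler/Nikulin transitivity `f v₀ = v` (`exists_isometryEquiv_apply_eq_of_primitive`), so `ι := f ∘ ι₀` has
`ι(L) = v^⊥ ∋ j(h)`, `ι(L)^⊥ = ℤv`, and `T_ι(h₁) = (ℤ j h ⊔ ℤ j δ)^⊥⊥ = j(P)` (both primitive of rank `2`).
§2 `Λ_n ↪ Λ̃ = E₈(−1)^{⊕2} ⊕ U^{⊕4}`, `n ≥ 2` (`k3HilbertLattice_exists_isometryEquiv_pairIsometry`): for every primitive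
`ι₀ : Λ_n ↪ Λ̃` and every even positive definite rank-2 `(P, C)` with `0 ≠ h ⊥ δ`, `δ` primitive, `(δ, δ) = 2n − 2`,
some `ι = f ∘ ι₀` in the `O(Λ̃)`-orbit of `ι₀` and `h₁ ∈ Λ_n` realise `(P, h) ≅ (T(h₁), ι h₁)`.

## References

* [Apostolov2014NotConnected] A. Apostolov, Moduli spaces of polarized irreducible symplectic manifolds are not
  necessarily connected, Ann. Inst. Fourier 64 (2014) 189–202 (arXiv:1109.0175): §2 Prop. 2.3 and its proof; §1
  (definition of `Σ_n`).
* [Nikulin1980] V. V. Nikulin, Integral symmetric bilinear forms and some of their applications (1980): Thm. 1.1.2,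
  Thm. 1.14.4.
-/

noncomputable section

open Module Function
open LinearMap (BilinForm)
open Literature.Topology.FourManifolds Literature.AlgebraicGeometry.Surfaces

namespace LinearMap.BilinForm

/-! ### §1 Realising an abstract pair inside the orbit of a reference embedding -/

section Realise

variable {X : Type*} [AddCommGroup X] [Module.Finite ℤ X] [Module.Free ℤ X] (Λ : BilinForm ℤ X)
variable {M : Type*} [AddCommGroup M] {L : BilinForm ℤ M}
variable {P : Type*} [AddCommGroup P] [Module.Finite ℤ P] [Module.Free ℤ P] {C : BilinForm ℤ P}

/-- **Prop. 2.3, lattice part: every abstract pair is realised in the orbit of a reference embedding.** `Λ` even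
unimodular with `n₊(Λ), n₋(Λ) ≥ 2`; `ι₀ : L → Λ` isometric with `ι₀(L) = v₀^⊥`, `v₀` primitive; `(P, C)` even
non-degenerate of rank `2` with `h, δ ∈ P`, `(h, h) ≠ 0`, `(h, δ) = 0`, `δ` primitive, `(δ, δ) = (v₀, v₀) ≠ 0`. Then for
some `f ∈ O(Λ)` and `h₁ ∈ L` there is an isometric isomorphism `e : P ≅ T_{f∘ι₀}(h₁)` with `e(h) = f(ι₀ h₁)` — "we may
choose a primitive isometric embedding `j : T ↪ Λ̃` […] we may find an embedding `ι` in the `O(Λ̃)`-orbit `[ι̃]` that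
`ι(Λ_n)^⊥ = ⟨j(δ)⟩`, since `O(Λ̃)` acts transitively on primitive elements. In particular, `j(h) ∈ ι(Λ_n)` […]
`h₁ := ι⁻¹(j(h))`"; and `T_ι(h₁) = j(P)` as both are primitive of rank `2`.
[cite: Apostolov2014NotConnected, §2 Prop. 2.3 (proof)] [cite: Nikulin1980, Thm. 1.1.2, Thm. 1.14.4] -/
theorem exists_embedding_pairIsometry (hΛ : Λ.IsSymm) (hu : Λ.IsUnimodular) (he : Λ.IsEven)
    (h2 : 2 ≤ sigPos Λ.toQuadraticMap) (h2' : 2 ≤ sigNeg Λ.toQuadraticMap) {ι₀ : M →ₗ[ℤ] X}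
    (h₀C : ∀ x y, Λ (ι₀ x) (ι₀ y) = L x y) {v₀ : X} (hrange₀ : LinearMap.range ι₀ = Λ.orthogonal (ℤ ∙ v₀))
    (hprim₀ : ∀ (k : ℤ) (w : X), k ≠ 0 → k • w ∈ ℤ ∙ v₀ → w ∈ ℤ ∙ v₀)
    (hC : C.IsSymm) (hCe : C.IsEven) (hCnd : C.Nondegenerate) (hP : finrank ℤ P = 2) {h δ : P} (hh : C h h ≠ 0)
    (hhδ : C h δ = 0) (hδ : C δ δ = Λ v₀ v₀) (hδ0 : C δ δ ≠ 0)
    (hδprim : ∀ (k : ℤ) (p : P), k ≠ 0 → k • p ∈ ℤ ∙ δ → p ∈ ℤ ∙ δ) :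
    ∃ (f : Λ.IsometryEquiv Λ) (h₁ : M)
      (e : P ≃ₗ[ℤ] Λ.orthogonal (Λ.orthogonal ((ℤ ∙ ((f.toLinearEquiv : X →ₗ[ℤ] X) ∘ₗ ι₀) h₁) ⊔
        Λ.orthogonal (LinearMap.range ((f.toLinearEquiv : X →ₗ[ℤ] X) ∘ₗ ι₀))))),
      (∀ p q, Λ (e p) (e q) = C p q) ∧ (e h : X) = ((f.toLinearEquiv : X →ₗ[ℤ] X) ∘ₗ ι₀) h₁ := by
  haveI : Λ.IsPerfPair := hu
  -- a primitive embedding `j : T ↪ Λ`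
  obtain ⟨j, hj, hjC, hjsat⟩ := exists_primitiveEmbedding_of_finrank_le_sigPos_sigNeg' C Λ hCnd hC hCe hΛ hu he
    (by rw [hP]; norm_num) (by rw [hP]; exact h2) (by rw [hP]; exact h2')
  -- `v := j δ` is primitive with `(v, v) = (v₀, v₀)`; Eichler moves `v₀` to `v`
  have hvprim : ∀ (k : ℤ) (w : X), k ≠ 0 → k • w ∈ ℤ ∙ j δ → w ∈ ℤ ∙ j δ := by
    intro k w hk hw
    obtain ⟨c, hc⟩ := Submodule.mem_span_singleton.1 hw
    have hw' : w ∈ LinearMap.range j := hjsat k w hk (by rw [← hc, ← map_zsmul]; exact LinearMap.mem_range_self j _)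
    obtain ⟨p, rfl⟩ := LinearMap.mem_range.1 hw'
    have hkp : k • p ∈ ℤ ∙ δ := by
      refine Submodule.mem_span_singleton.2 ⟨c, hj ?_⟩
      rw [map_zsmul, map_zsmul, hc]
    obtain ⟨d, hd⟩ := Submodule.mem_span_singleton.1 (hδprim k p hk hkp)
    exact Submodule.mem_span_singleton.2 ⟨d, by rw [← hd, map_zsmul]⟩
  have hv₀0 : v₀ ≠ 0 := by
    rintro rfl
    apply hδ0
    rw [hδ]
    simp
  have hv0 : j δ ≠ 0 := by
    intro h0
    apply hδ0
    rw [← hjC, h0]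
    simp
  obtain ⟨f, hf⟩ := exists_isometryEquiv_apply_eq_of_primitive Λ hΛ hu he h2 h2' (by rw [← hδ, hjC] : Λ v₀ v₀ = Λ (j δ) (j δ))
    hv₀0 hprim₀ hv0 hvprim
  -- `ι := f ∘ ι₀` has `ι(L) = v^⊥`
  have hrange : LinearMap.range ((f.toLinearEquiv : X →ₗ[ℤ] X) ∘ₗ ι₀) = Λ.orthogonal (ℤ ∙ j δ) := by
    rw [LinearMap.range_comp, hrange₀, map_orthogonal_span_singleton, hf]
  have hιC : ∀ x y, Λ (((f.toLinearEquiv : X →ₗ[ℤ] X) ∘ₗ ι₀) x) (((f.toLinearEquiv : X →ₗ[ℤ] X) ∘ₗ ι₀) y) = L x y :=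
    fun x y ↦ by rw [LinearMap.comp_apply, LinearMap.comp_apply]; exact (f.map_app _ _).trans (h₀C x y)
  have hSv : Λ.orthogonal (LinearMap.range ((f.toLinearEquiv : X →ₗ[ℤ] X) ∘ₗ ι₀)) = ℤ ∙ j δ := by
    rw [hrange, orthogonal_orthogonal_eq_of_forall_smul_mem Λ _ hΛ hvprim]
  -- `j h ∈ v^⊥ = ι(L)`
  have hjh : j h ∈ LinearMap.range ((f.toLinearEquiv : X →ₗ[ℤ] X) ∘ₗ ι₀) := by
    rw [hrange, mem_orthogonal_iff]
    intro n hn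
    obtain ⟨c, rfl⟩ := Submodule.mem_span_singleton.1 hn
    change Λ (c • j δ) (j h) = 0
    rw [map_smul, LinearMap.smul_apply, hjC, hC.eq, hhδ, smul_zero]
  obtain ⟨h₁, hh₁⟩ := LinearMap.mem_range.1 hjh
  have hh₁' : L h₁ h₁ ≠ 0 := by rwa [← hιC, hh₁, hjC]
  -- `T(h₁) = j(P)`
  have hT : Λ.orthogonal (Λ.orthogonal ((ℤ ∙ ((f.toLinearEquiv : X →ₗ[ℤ] X) ∘ₗ ι₀) h₁) ⊔
      Λ.orthogonal (LinearMap.range ((f.toLinearEquiv : X →ₗ[ℤ] X) ∘ₗ ι₀)))) = LinearMap.range j := by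
    have hle : (ℤ ∙ ((f.toLinearEquiv : X →ₗ[ℤ] X) ∘ₗ ι₀) h₁) ⊔
        Λ.orthogonal (LinearMap.range ((f.toLinearEquiv : X →ₗ[ℤ] X) ∘ₗ ι₀)) ≤ LinearMap.range j := by
      rw [hSv, hh₁]
      exact sup_le (Submodule.span_le.2 (Set.singleton_subset_iff.2 (LinearMap.mem_range_self j h)))
        (Submodule.span_le.2 (Set.singleton_subset_iff.2 (LinearMap.mem_range_self j δ)))
    have hle' : Λ.orthogonal (Λ.orthogonal ((ℤ ∙ ((f.toLinearEquiv : X →ₗ[ℤ] X) ∘ₗ ι₀) h₁) ⊔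
        Λ.orthogonal (LinearMap.range ((f.toLinearEquiv : X →ₗ[ℤ] X) ∘ₗ ι₀)))) ≤ LinearMap.range j := by
      rw [← orthogonal_orthogonal_eq_of_forall_smul_mem Λ _ hΛ hjsat]
      exact Λ.orthogonal_le (Λ.orthogonal_le hle)
    refine eq_of_le_of_finrank_le_of_forall_smul_mem (fun k w hk hw ↦ Λ.mem_orthogonal_of_smul_mem _ hk hw) hle' ?_
    rw [Λ.finrank_orthogonal_orthogonal_span_sup_eq_two hΛ hιC (by rw [hjC]; exact hδ0) hrange hSv hh₁',
      LinearMap.finrank_range_of_inj hj, hP]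
  refine ⟨f, h₁, (LinearEquiv.ofInjective j hj).trans (LinearEquiv.ofEq _ _ hT.symm), fun p q ↦ hjC p q, ?_⟩
  exact hh₁.symm

end Realise

end LinearMap.BilinForm

namespace Literature.AlgebraicGeometry.Hyperkaehler

open Literature.Topology.FourManifolds Literature.AlgebraicGeometry.Surfaces LinearMap.BilinForm

/-! ### §2 `Λ_n ↪ Λ̃` -/

/-- **Prop. 2.3 (lattice part) for `Λ_n = Λ(K3^{[n]}) ↪ Λ̃ = E₈(−1)^{⊕2} ⊕ U^{⊕4}`, `n ≥ 2`**: given any primitive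
isometric `ι₀ : Λ_n ↪ Λ̃` ("`ι̃`") and any even positive definite rank-2 lattice `(P, C)` with `0 ≠ h ∈ P`, `h ⊥ δ`,
`δ` primitive, `(δ, δ) = 2n − 2` (a representative of a class in `Σ_n`), there are `f ∈ O(Λ̃)`, `h₁ ∈ Λ_n` and an
isometric isomorphism `e : P ≅ T(h₁)` for the embedding `ι = f ∘ ι₀` of the same `O(Λ̃)`-orbit, with `e(h) = ι(h₁)`
— every element of `Σ_n` is a value of the invariant. [cite: Apostolov2014NotConnected, §2 Prop. 2.3 (proof, lattice
part)] -/
theorem k3HilbertLattice_exists_isometryEquiv_pairIsometry {n : ℕ} (hn : 2 ≤ n)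
    {ι₀ : (K3HilbertIndex → ℤ) →ₗ[ℤ] (Fin 2 → Fin 8 → ℤ) × ((Fin 4 → ℤ) × (Fin 4 → ℤ))} (h₀inj : Function.Injective ι₀)
    (h₀C : ∀ x y, ((LinearMap.BilinForm.pi fun _ : Fin 2 ↦ -e8Form).prod (hyperbolicSum 4)) (ι₀ x) (ι₀ y) =
      Matrix.toBilin' (k3HilbertGram n) x y)
    (h₀sat : ∀ (k : ℤ) z, k ≠ 0 → k • z ∈ LinearMap.range ι₀ → z ∈ LinearMap.range ι₀)
    {P : Type*} [AddCommGroup P] [Module.Finite ℤ P] [Module.Free ℤ P] {C : LinearMap.BilinForm ℤ P}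
    (hC : C.IsSymm) (hCe : C.IsEven) (hpos : ∀ p, p ≠ 0 → 0 < C p p) (hP : finrank ℤ P = 2) {h δ : P}
    (hh : h ≠ 0) (hhδ : C h δ = 0) (hδ : C δ δ = 2 * (n - 1 : ℕ))
    (hδprim : ∀ (k : ℤ) (p : P), k ≠ 0 → k • p ∈ ℤ ∙ δ → p ∈ ℤ ∙ δ) :
    ∃ (f : ((LinearMap.BilinForm.pi fun _ : Fin 2 ↦ -e8Form).prod (hyperbolicSum 4)).IsometryEquiv
        ((LinearMap.BilinForm.pi fun _ : Fin 2 ↦ -e8Form).prod (hyperbolicSum 4))) (h₁ : K3HilbertIndex → ℤ)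
      (e : P ≃ₗ[ℤ] ((LinearMap.BilinForm.pi fun _ : Fin 2 ↦ -e8Form).prod (hyperbolicSum 4)).orthogonal
        (((LinearMap.BilinForm.pi fun _ : Fin 2 ↦ -e8Form).prod (hyperbolicSum 4)).orthogonal
          ((ℤ ∙ ((f.toLinearEquiv : _ →ₗ[ℤ] _) ∘ₗ ι₀) h₁) ⊔
            ((LinearMap.BilinForm.pi fun _ : Fin 2 ↦ -e8Form).prod (hyperbolicSum 4)).orthogonal
              (LinearMap.range ((f.toLinearEquiv : _ →ₗ[ℤ] _) ∘ₗ ι₀))))),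
      (∀ p q, ((LinearMap.BilinForm.pi fun _ : Fin 2 ↦ -e8Form).prod (hyperbolicSum 4)) (e p) (e q) = C p q) ∧
        (e h : (Fin 2 → Fin 8 → ℤ) × ((Fin 4 → ℤ) × (Fin 4 → ℤ))) = ((f.toLinearEquiv : _ →ₗ[ℤ] _) ∘ₗ ι₀) h₁ := by
  obtain ⟨hs, hev, hu⟩ := isSymm_isEven_isUnimodular_pi_neg_e8Form_prod_hyperbolicSum' 2 4
  obtain ⟨hp, hng⟩ := sigPos_sigNeg_pi_neg_e8Form_prod_hyperbolicSum 2 4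
  obtain ⟨v₀, hprim₀, hrange₀, -, hvv₀⟩ := k3HilbertLattice_exists_range_eq_orthogonal_of_saturated hn h₀inj h₀C h₀sat
  have hCnd : C.Nondegenerate := by
    refine (LinearMap.IsRefl.nondegenerate_iff_separatingLeft hC.isRefl).2 fun x hx ↦ ?_
    by_contra hx0
    exact (hpos x hx0).ne' (hx x)
  have h2 : 2 ≤ sigPos ((LinearMap.BilinForm.pi fun _ : Fin 2 ↦ -e8Form).prod (hyperbolicSum 4)).toQuadraticMap := by
    rw [hp]; norm_num
  have h2' : 2 ≤ sigNeg ((LinearMap.BilinForm.pi fun _ : Fin 2 ↦ -e8Form).prod (hyperbolicSum 4)).toQuadraticMap := by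
    rw [hng]; norm_num
  have hδ0 : C δ δ ≠ 0 := by rw [hδ]; omega
  have hδ' : C δ δ = ((LinearMap.BilinForm.pi fun _ : Fin 2 ↦ -e8Form).prod (hyperbolicSum 4)) v₀ v₀ := by
    rw [hδ, hvv₀]
  exact exists_embedding_pairIsometry _ hs hu hev h2 h2' h₀C hrange₀ hprim₀ hC hCe hCnd hP (hpos h hh).ne' hhδ hδ' hδ0
    hδprim

end Literature.AlgebraicGeometry.Hyperkaehler

end
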